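import Summits.QuantumFields.BalabanUV.T4Continuum.Spine.NE1p.DressedSizeDominationBasicStep
import Literature.MathematicalPhysics.QuantumFieldTheory.Balaban1983to89.T4GenFunBounds

/-!
# T⁴ programme, spine estimate NE1′ — the MGF form ALONG ANY CHAIN of the run's value maps: convention (α) is
# positive-LINEAR, so every dressed term total is an integral of the dressing against a measure on the ORIGINAL space

Cell `pub-balaban-gaps` (track G2), seat `ne1` gen 2 (prover-pub-balaban-gaps-ne1-g2-0), record `HOME/ne/NE1.md` §4 R22;
ADDITIVE — imports gen 0's `DressedSizeDominationBasicStep` (p339692) and the tree's `T4GenFunBounds` only, modifies nothing;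
sibling of the seat's `Spine/NE1p/DressedMGFForm.lean` (the consumer side of the same reading), independent of it.

WHAT THIS IS.  Gen 0 (`DressedSizeDomination` §1) READ every value map of Bałaban's run — insertion `mulOp χ`, positive
kernel `kernelOp κ μ` (a sharp renormalisation transformation or a fibre integration), the basic ℝ-step in convention (α)
`ratioOp ins d Q` ([Balaban1989LargeFieldI] (0.3) p. 176, (1.100) p. 201: SHAPE only) — as monotone positively-homogeneous
and proved two-sided domination along any chain `iter Φ`.  `DressedMGFForm` READ the same maps as positive-LINEAR and took
the consequence — «term total = MGF of the observable under a measure on the original space» — as the hypothesis shape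
`MGFForm`, derived at birth and through ONE ℝ-step on the (0.3) model.  This module makes the linear reading a THEOREM at
gen 0's abstraction level: each of the three maps is REPRESENTED BY A MEASURABLE KERNEL (Mathlib `ProbabilityTheory.Kernel`)
on measurable inputs (`IsKernelRepr`; `isKernelRepr_mulOp`, `_kernelOp`, `_ratioOp`, under the measurability provisos the
tree's one-step model carries anyway), kernel representations COMPOSE (`IsKernelRepr.comp`, Mathlib `Kernel.comp` /
`lintegral_comp`), hence every iterate of a chain of such maps is represented by the composed kernel (`isKernelRepr_iter`),
the TOTAL of the descendant of `g` after `n` steps is `∫ g d(μ.bind Kₙ)` (`lintegral_iter_eq_lintegral_bind`), and for the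
dressed initial density `f₀ · e^{tF}` it is the MGF of `F` under the finite measure `(μ.bind Kₙ).withDensity f₀` on the
ORIGINAL space — `MGFForm`'s `repr` clause along a whole lineage (`toReal_lintegral_iter_dressed_eq_mgf`).  §4: a two-point
witness that the binder `TiltedMeanMatching` is load-bearing (`dressed_core_fails_without_matching`).  With the size
half (gen 0) and the consumer side (`DressedMGFForm`) this closes the abstract side of NE1′ as its consumer reads it: what is
left is the two-run binder `DressedMGFForm.TiltedMeanMatching` and, on the datum, the presentation of
`T4Continuum.Realisation.R` as such a chain — the OBJECT the tree does not have ((B) 0∕13).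

WHAT THIS IS NOT.  Not NE1′; nothing instantiated on Bałaban's densities; `Realisation.R` stays a black box beyond (0.4).
Rung (B)+1 bookkeeping on ONE finite four-torus — NOT infinite volume, NOT a mass gap, NOT OS on ℝ⁴, NOT Clay; spine PROVED
0∕9; (B) 0∕13.  Every declaration is [folklore] (Mathlib `Kernel`, `Measure.bind`, `withDensity`, `lintegral_dirac'`).
-/

noncomputable section

namespace Summit.QuantumFields.BalabanUV.T4Continuum.NE1p.DressedMGFFormChain

open MeasureTheory ProbabilityTheory ProbabilityTheory.Kernel
open scoped ENNReal
open Summit.QuantumFields.BalabanUV.T4Continuum.NE1p.DressedSizeDomination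

variable {X Y Z : Type*} [MeasurableSpace X] [MeasurableSpace Y] [MeasurableSpace Z]

/-! ## §1 Kernel-represented value maps and their composition -/

/-- A value map `Φ` is REPRESENTED BY THE KERNEL `κ` (from the new variables back to the old ones) on measurable inputs:
`Φ f = (y ↦ ∫ f dκ(y))`.  Positive-linearity made concrete. [folklore] -/
def IsKernelRepr (Φ : (X → ℝ≥0∞) → (Y → ℝ≥0∞)) (κ : Kernel Y X) : Prop :=
  ∀ f : X → ℝ≥0∞, Measurable f → Φ f = fun y => ∫⁻ x, f x ∂(κ y)

omit [MeasurableSpace Z] in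
/-- A kernel-represented map sends measurable inputs to measurable outputs. [folklore] -/
theorem IsKernelRepr.measurable {Φ : (X → ℝ≥0∞) → (Y → ℝ≥0∞)} {κ : Kernel Y X} (h : IsKernelRepr Φ κ)
    {f : X → ℝ≥0∞} (hf : Measurable f) : Measurable (Φ f) := by
  rw [h f hf]; exact hf.lintegral_kernel

/-- **COMPOSITION**: if `Φ` is represented by `κ` and `Ψ` by `η`, then `Ψ ∘ Φ` is represented by the composed kernel
`κ ∘ₖ η` (Mathlib `Kernel.lintegral_comp`). [folklore] -/
theorem IsKernelRepr.comp {Φ : (X → ℝ≥0∞) → (Y → ℝ≥0∞)} {Ψ : (Y → ℝ≥0∞) → (Z → ℝ≥0∞)} {κ : Kernel Y X}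
    {η : Kernel Z Y} (hΨ : IsKernelRepr Ψ η) (hΦ : IsKernelRepr Φ κ) : IsKernelRepr (Ψ ∘ Φ) (κ ∘ₖ η) := by
  intro f hf
  funext z
  show Ψ (Φ f) z = _
  rw [hΦ f hf, hΨ _ hf.lintegral_kernel, Kernel.lintegral_comp _ _ _ hf]

/-! ## §2 The three value maps of the run are kernel-represented -/

omit [MeasurableSpace Y] [MeasurableSpace Z] in
/-- The kernel of an INSERTION `f ↦ χ·f`: `y ↦ χ(y)·δ_y`. [folklore] -/
def mulKernel (χ : X → ℝ≥0∞) (hχ : Measurable χ) : Kernel X X where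
  toFun y := χ y • Measure.dirac y
  measurable' := by
    refine Measure.measurable_of_measurable_coe _ fun s hs => ?_
    simp only [Measure.smul_apply, smul_eq_mul, Measure.dirac_apply' _ hs]
    exact hχ.mul (measurable_one.indicator hs)

omit [MeasurableSpace Y] [MeasurableSpace Z] in
/-- `mulOp χ` is represented by `mulKernel χ` (for measurable `χ`). [folklore] -/
theorem isKernelRepr_mulOp {χ : X → ℝ≥0∞} (hχ : Measurable χ) : IsKernelRepr (mulOp χ) (mulKernel χ hχ) := by
  intro f hf
  funext y
  show χ y * f y = ∫⁻ x, f x ∂(χ y • Measure.dirac y)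
  rw [lintegral_smul_measure, lintegral_dirac' _ hf, smul_eq_mul]

omit [MeasurableSpace Z] in
/-- The kernel of a POSITIVE KERNEL OPERATOR `f ↦ (y ↦ ∫ κ(y,x) f(x) dμ)` with jointly measurable density `κ` over an
s-finite reference measure: `y ↦ μ.withDensity κ(y,·)`. [folklore] -/
def densityKernel (κ : Y → X → ℝ≥0∞) (hκ : Measurable (Function.uncurry κ)) (μ : Measure X) [SFinite μ] :
    Kernel Y X where
  toFun y := μ.withDensity (κ y)
  measurable' := by
    refine Measure.measurable_of_measurable_coe _ fun s hs => ?_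
    simp only [withDensity_apply _ hs, ← lintegral_indicator hs]
    refine Measurable.lintegral_prod_right' (f := fun p : Y × X => s.indicator (κ p.1) p.2) ?_
    exact (hκ.indicator (hs.preimage measurable_snd) : _)

omit [MeasurableSpace Z] in
/-- `kernelOp κ μ` is represented by `densityKernel κ μ`. [folklore] -/
theorem isKernelRepr_kernelOp {κ : Y → X → ℝ≥0∞} (hκ : Measurable (Function.uncurry κ)) (μ : Measure X) [SFinite μ] :
    IsKernelRepr (kernelOp κ μ) (densityKernel κ hκ μ) := by
  intro f hf
  funext y
  show ∫⁻ x, κ y x * f x ∂μ = ∫⁻ x, f x ∂(μ.withDensity (κ y))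
  rw [lintegral_withDensity_eq_lintegral_mul μ (hκ.of_uncurry_left) hf]
  rfl

omit [MeasurableSpace Z] in
/-- The kernel of THE BASIC ℝ-STEP IN CONVENTION (α) `f ↦ ins·Q(f)/d` when the fibre integration `Q` is represented by
`κ_Q`: `y ↦ (ins y / d y) · κ_Q(y)` (undressed insert and normalisation are SCALARS at the new field). [folklore] -/
def ratioKernel (ins d : Y → ℝ≥0∞) (hins : Measurable ins) (hd : Measurable d) (κQ : Kernel Y X) : Kernel Y X where
  toFun y := (ins y / d y) • κQ y
  measurable' := by
    refine Measure.measurable_of_measurable_coe _ fun s hs => ?_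
    simp only [Measure.smul_apply, smul_eq_mul]
    exact (hins.div hd).mul (κQ.measurable_coe hs)

omit [MeasurableSpace Z] in
/-- `ratioOp ins d Q` is represented by `ratioKernel ins d κ_Q` when `Q` is represented by `κ_Q`. [folklore] -/
theorem isKernelRepr_ratioOp {ins d : Y → ℝ≥0∞} (hins : Measurable ins) (hd : Measurable d)
    {Q : (X → ℝ≥0∞) → (Y → ℝ≥0∞)} {κQ : Kernel Y X} (hQ : IsKernelRepr Q κQ) :
    IsKernelRepr (ratioOp ins d Q) (ratioKernel ins d hins hd κQ) := by
  intro f hf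
  funext y
  show ins y * Q f y / d y = ∫⁻ x, f x ∂((ins y / d y) • κQ y)
  rw [lintegral_smul_measure, smul_eq_mul, hQ f hf, ENNReal.mul_div_right_comm]

/-! ## §3 Along a chain: the composed kernel, the total as a `bind`, and the MGF form of every dressed descendant -/

/-- The kernel representing `n` steps of a chain of value maps with step kernels `κ 0, κ 1, …` (from the variables after
`n` steps back to the ORIGINAL variables): `K 0 = id`, `K (n+1) = K n ∘ₖ κ n`. [folklore] -/
def chainKernel (κ : ℕ → Kernel X X) : ℕ → Kernel X X
  | 0 => Kernel.id
  | n + 1 => chainKernel κ n ∘ₖ κ n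

omit [MeasurableSpace Y] [MeasurableSpace Z] in
/-- **EVERY ITERATE OF A CHAIN OF KERNEL-REPRESENTED MAPS IS KERNEL-REPRESENTED** by the composed kernel (gen 0's
`DressedSizeDomination.iter`). [folklore] -/
theorem isKernelRepr_iter {Φ : ℕ → (X → ℝ≥0∞) → (X → ℝ≥0∞)} {κ : ℕ → Kernel X X}
    (h : ∀ n, IsKernelRepr (Φ n) (κ n)) : ∀ n, IsKernelRepr (fun f => iter Φ f n) (chainKernel κ n)
  | 0 => fun f hf => by
      funext y
      show f y = ∫⁻ x, f x ∂(Kernel.id y)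
      rw [Kernel.lintegral_id' hf]
  | n + 1 => fun f hf => by
      have ih : iter Φ f n = fun y => ∫⁻ x, f x ∂(chainKernel κ n y) := isKernelRepr_iter h n f hf
      funext y
      show Φ n (iter Φ f n) y = ∫⁻ x, f x ∂((chainKernel κ n ∘ₖ κ n) y)
      rw [ih, h n _ hf.lintegral_kernel, Kernel.lintegral_comp _ _ _ hf]

omit [MeasurableSpace Y] [MeasurableSpace Z] in
/-- **THE TOTAL OF A DESCENDANT IS AN INTEGRAL ON THE ORIGINAL SPACE**: `∫ (iter Φ g n) dμ = ∫ g d(μ.bind Kₙ)` for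
measurable `g` (Mathlib `Measure.lintegral_bind`). [folklore] -/
theorem lintegral_iter_eq_lintegral_bind {Φ : ℕ → (X → ℝ≥0∞) → (X → ℝ≥0∞)} {κ : ℕ → Kernel X X}
    (h : ∀ n, IsKernelRepr (Φ n) (κ n)) (μ : Measure X) {g : X → ℝ≥0∞} (hg : Measurable g) (n : ℕ) :
    ∫⁻ y, iter Φ g n y ∂μ = ∫⁻ x, g x ∂(μ.bind (chainKernel κ n)) := by
  rw [show iter Φ g n = fun y => ∫⁻ x, g x ∂(chainKernel κ n y) from isKernelRepr_iter h n g hg,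
    Measure.lintegral_bind (Kernel.aemeasurable _) hg.aemeasurable]

omit [MeasurableSpace Y] [MeasurableSpace Z] in
/-- **THE MGF FORM ALONG A WHOLE LINEAGE.**  For a chain of kernel-represented value maps, a measurable undressed initial
density `f₀` and a measurable observable `F`, the TOTAL of the descendant after `n` steps of the DRESSED initial density
`f₀ · e^{tF}` is the moment generating function of `F` under the measure `νₙ = (μ.bind Kₙ).withDensity f₀` on the ORIGINAL
space: `(∫ iter Φ (f₀·e^{tF}) n dμ).toReal = mgf F νₙ t` — `DressedMGFForm.MGFForm`'s `repr` clause history by history,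
for any number of steps. [folklore] -/
theorem toReal_lintegral_iter_dressed_eq_mgf {Φ : ℕ → (X → ℝ≥0∞) → (X → ℝ≥0∞)} {κ : ℕ → Kernel X X}
    (h : ∀ n, IsKernelRepr (Φ n) (κ n)) (μ : Measure X) {f₀ : X → ℝ≥0∞} (hf₀ : Measurable f₀) {F : X → ℝ}
    (hF : Measurable F) (t : ℝ) (n : ℕ) :
    (∫⁻ y, iter Φ (f₀ * fun x => ENNReal.ofReal (Real.exp (t * F x))) n y ∂μ).toReal
      = mgf F ((μ.bind (chainKernel κ n)).withDensity f₀) t := by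
  have hw : Measurable fun x => ENNReal.ofReal (Real.exp (t * F x)) :=
    ENNReal.measurable_ofReal.comp (Real.measurable_exp.comp (hF.const_mul t))
  rw [lintegral_iter_eq_lintegral_bind h μ (hf₀.mul hw) n,
    ← lintegral_withDensity_eq_lintegral_mul _ hf₀ hw, mgf,
    integral_eq_lintegral_of_nonneg_ae (ae_of_all _ fun x => (Real.exp_pos _).le)
      (Real.measurable_exp.comp (hF.const_mul t)).aestronglyMeasurable]

/-! ## §4 Sanity: the two-run binder is not idle — tilted means CAN differ by `2B` while the undressed data coincide -/

/-- **THE BINDER `TiltedMeanMatching` IS LOAD-BEARING (witness).**  Two one-point «runs» with the SAME undressed data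
(unit mass each, so every undressed core sandwich holds with constant `c = 0` and width `0`) but observables `+B` and `−B`:
the dressed totals are `e^{tB}` and `e^{−tB}`, the tilted means are `+B` and `−B` at every tilt, and at `t = −l₀` the dressed
upper sandwich `Q ≤ e^{c + W}·P` with `c = 0` FAILS for every width `W < 2·l₀·B`.  So no width independent of the runs'
first-moment discrepancy can serve in `DressedMGFForm.core_of_mgfForm`: the dressing's load on `core` is a genuine two-run
condition, not an artefact of the bookkeeping. [folklore] -/
theorem dressed_core_fails_without_matching {B l₀ W : ℝ} (hW : W < 2 * l₀ * B) :
    let P : ℝ → ℝ := fun t => ProbabilityTheory.mgf (fun _ : Unit => B) (Measure.dirac ()) t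
    let Q : ℝ → ℝ := fun t => ProbabilityTheory.mgf (fun _ : Unit => -B) (Measure.dirac ()) t
    P 0 = Q 0 ∧ ¬ (Q (-l₀) ≤ Real.exp (0 + W) * P (-l₀)) := by
  have hP : ∀ t, ProbabilityTheory.mgf (fun _ : Unit => B) (Measure.dirac ()) t = Real.exp (t * B) := fun t => by
    simp [ProbabilityTheory.mgf]
  have hQ : ∀ t, ProbabilityTheory.mgf (fun _ : Unit => -B) (Measure.dirac ()) t = Real.exp (t * -B) := fun t => by
    simp [ProbabilityTheory.mgf]
  refine ⟨by simp [hP, hQ], fun h => ?_⟩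
  simp only [hP, hQ, zero_add, ← Real.exp_add, Real.exp_le_exp] at h
  linarith

end Summit.QuantumFields.BalabanUV.T4Continuum.NE1p.DressedMGFFormChain

end
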